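import Literature.Computability.AlgebraicComplexity.BorderRankMatMulFiveSS21RowsA
import Literature.Computability.AlgebraicComplexity.BorderRankMatMulFiveSS21RowsB
import Literature.Computability.AlgebraicComplexity.BorderRankMatMulFiveSS21RowsC
import HarnessLib

/-!
# `bR(⟨5,5,5⟩) ≤ 89` (Sedoglavic–Smirnov 2021): the explicit approximate algorithm with 89 multiplications, kernel-checked — the ASSEMBLY file (check + bounds)

Topic `Literature/Computability/AlgebraicComplexity`; a five-file kernel certificate (this is the ASSEMBLY file (check + bounds)):
`BorderRankMatMulFiveSS21Data.lean` (the `89` triads), `…RowsA/B/C.lean` (the finite check, rows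
`0–8 / 9–16 / 17–24` of the `C`-slot, one `decide +kernel` per row, ≈ 20 s each on the farm — hence the
split), `BorderRankMatMulFiveSS21.lean` (assembly and the bounds).  Siblings: `BorderRankMatMulThreeSmirnov.lean`
(`bR(⟨3,3,3⟩) ≤ 20`), `BorderRankMatMulFourSmirnov.lean` (`bR(⟨4,4,4⟩) ≤ 46`), same toolkit
(`MatMulBorderRankCertificate.lean`).

THE RESULT: A. Sedoglavic, A. V. Smirnov, *The tensor rank of 5×5 matrices multiplication is bounded by
98 and its border rank by 89*, ISSAC 2021 = arXiv:2101.12568 (held: `paper:arxiv-2101.12568`), §4.2: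
"Using the approximate matrix multiplication tensor defined in the previous section and the construction
made in Equation (eq:approx_5x3x3), one can construct easily: `⟨5×5×5:89⟩ = T_ε + ⟨3×3×3:20⟩ + ⟨2×3×3:14⟩`.
Remark that the best theoretical lower bound on the corresponding border rank is 45".  Here `T_ε` (§4.1,
printed in full as `ρ₂₂₂ + ρ₂₂₁ + ρ₂₁₂ + ρ₁₂₂ + ρ₂₁₁ + ρ₁₂₁ + ρ₁₁₂ + ρ₁₁₁`, 55 trilinear terms with
Laurent-polynomial coefficients in `ε`) "defines an algorithm computing the product of a 5×5-matrix `A`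
with 9 vanishing elements: `a_{ij} = 0` for `1 ≤ i ≤ 3`, `3 ≤ j ≤ 5`, and a full 5×5-matrix `B`"; the
missing block (rows `1–3`, columns `3–5` of `A`, times rows `3–5` of `B`) is a `⟨3,3,5⟩ = ⟨3,3,3⟩ ⊕ ⟨3,3,2⟩`
supplied by Smirnov's approximate algorithms of lengths `20` and `14` (both already kernel certificates
in the tree: `BorderRankMatMulThreeSmirnov.lean`, `BorderRankMatMulSmallProofs.lean`).

## The data and where they come from

* `T_ε`: the 55 terms were PARSED from the LaTeX source of arXiv:2101.12568 §4.1 (held text, chunks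
  10–11) — each term a product of a linear form in the `a_{ij}`, one in the `b_{jk}`, one in the `c_{ki}`
  (the paper's trace convention `∑ a_{ij} b_{jk} c_{ki}`; here `c_{ki}` is the coordinate `C(i,k)` of the
  product slot) with coefficients in `ℚ[ε, ε⁻¹]` (in fact `ℤ[ε, ε⁻¹]`).  In exact rational arithmetic the
  parsed sum equals the partial tensor `+ O(ε)` EXCEPT for three misprints of the arXiv source, corrected
  as follows (each correction is the unique / a minimal single-token change making the affected
  coefficients close, and is recorded here so that it can be audited against the printed version):
  (1) `ρ₁₂₂`, 3rd term: first factor `a₅₄/ε²` ↦ `a₅₄ε²` (else `a₅₄b₁₄c₄₁`, `a₅₄b₄₅c₂₅`, `a₅₄b₄₅c₄₂`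
  keep poles that terms 5–6 of `ρ₂₂₂` are visibly designed to cancel); (2) `ρ₁₁₁`, 2nd term: middle
  factor `b₁₁ε³ + b₂₁/ε` ↦ `b₁₁ε³ + b₂₁` (else `a₁₁b₂₁c₂₁`, `a₁₁b₂₁c₁₁` do not cancel against `ρ₂₂₂`
  term 1 / `ρ₁₁₂` term 5 and the product term `a₁₂b₂₁c₁₁` lands in degree `−1`); (3) `ρ₂₂₂`, 5th term:
  first factor `… + a₅₂ε³` ↦ `… + a₅₂ε⁴` (else `a₅₂b₁₄c₁₅` survives in degree `0`; the alternative
  correction `−a₅₂ε ↦ −a₅₂` in `ρ₂₂₁` term 1 closes the identity equally well — either way a valid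
  approximate algorithm of length 55 for the partial product results, which is all that is used).
* `⟨3,3,3; 20⟩`, `⟨3,3,2; 14⟩`: Smirnov's approximate algorithms as distributed with Benson–Ballard's
  *fast-matmul* (PPoPP 2015; files `codegen/algorithms/smirnov333-20-182-approx`,
  `smirnov332-14-108-approx`), placed on `A`-rows `1–3` × `A`-columns `3–5`, `B`-rows `3–5`, and
  `C`-columns `1–3` resp. `4–5`.
* The 89 triads together satisfy `∑ₜ αᵗ ⊗ βᵗ ⊗ γᵗ = ⟨5,5,5⟩ + O(ε)` — confirmed in exact rational
  arithmetic; clearing poles per product (total order `6`) gives INTEGER polynomial vectors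
  `Uₜ, Vₜ, Wₜ` (degrees `≤ 7, 5, 5`) with `∑ₜ Uₜ ⊗ Vₜ ⊗ Wₜ = x⁶ · ⟨5,5,5⟩ + O(x⁷)`, an order-`6`
  approximate decomposition with `89` triads and multiplier `1` (Bläser Def. 6.1) — re-confirmed in
  integer arithmetic before transcription.  The parsing / correction / assembly route is not trusted: the
  kernel check IS the proof of the theorem `bR(⟨5,5,5⟩) ≤ 89` (every commutative ring).

## References

* [SedoglavicSmirnov2021] A. Sedoglavic, A. V. Smirnov, ISSAC 2021, doi:10.1145/3452143.3465537 =
  arXiv:2101.12568 — §4.1 (`T_ε`), §4.2 (`⟨5,5,5; 89⟩`), abstract/title (border rank `≤ 89`).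
* [Smirnov2013] A. V. Smirnov, Comput. Math. Math. Phys. 53 (2013) 1781–1795 — `⟨3,3,3; 20⟩`,
  `⟨3,2,3; 14⟩`.
* [BensonBallard2015] A. R. Benson, G. Ballard, PPoPP 2015, doi:10.1145/2688500.2688513 — software
  `fast-matmul`, coefficient files.
* [Blaser2013] M. Bläser, *Fast Matrix Multiplication*, Theory of Computing Graduate Surveys 5 (2013)
  — Def. 6.1, Thm. 6.3(1).
-/

noncomputable section

open scoped BigOperators

namespace Literature.Computability.AlgebraicComplexity

namespace SedoglavicSmirnov2021.M555

/-- **The whole certificate checks**: `∑ₜ Uₜ ⊗ Vₜ ⊗ Wₜ = ε⁶ · ⟨5,5,5⟩ + O(ε⁷)` (flat format), from the 25 row checks. [cite: SedoglavicSmirnov2021, §4.2 (border rank of ⟨5,5,5⟩ ≤ 89)] -/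
theorem check : ApproxCert.check 25 25 25 89 6 1 (matMulFlat 5 5 5) (ptab cU) (ptab cV) (ptab cW) = true :=
  ApproxCert.check_of_forall_checkRow fun i => by
    fin_cases i
    exacts [row_0, row_1, row_2, row_3, row_4, row_5, row_6, row_7, row_8, row_9, row_10, row_11, row_12, row_13, row_14, row_15, row_16, row_17, row_18, row_19, row_20, row_21, row_22, row_23, row_24]

end SedoglavicSmirnov2021.M555

/-! ## The bounds -/

section Bounds

variable (K : Type*) [CommRing K]

/-- **`R₆(⟨5,5,5⟩) ≤ 89`** over every commutative ring (order-`6` approximate rank, Bläser's `R_h`): the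
Sedoglavic–Smirnov approximate algorithm `T_ε + ⟨3,3,3;20⟩ + ⟨3,3,2;14⟩`.
[cite: SedoglavicSmirnov2021, §4.2 (border rank of ⟨5,5,5⟩ ≤ 89)] -/
theorem SedoglavicSmirnov2021_approxRank_six_matMulTensor_five_le :
    approxRank 6 (matMulTensor K 5 5 5) ≤ 89 :=
  approxRank_matMulTensor_le_of_check K SedoglavicSmirnov2021.M555.check (by simp)

/-- **`bR(⟨5,5,5⟩) ≤ 89`** (Sedoglavic–Smirnov 2021), over every commutative ring.
[cite: SedoglavicSmirnov2021, §4.2 and title (border rank of ⟨5,5,5⟩ ≤ 89)] -/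
theorem SedoglavicSmirnov2021_algBorderRank_matMulTensor_five_le :
    algBorderRank (matMulTensor K 5 5 5) ≤ 89 :=
  algBorderRank_matMulTensor_le_of_check K SedoglavicSmirnov2021.M555.check (by simp)

end Bounds

end Literature.Computability.AlgebraicComplexity

end
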